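import Summits.KontsevichZagierPeriods.KontsevichZagierPeriods.Theorems.LinRedNormalFormArrangementNormalFormSeparateThreeHICore

/-!
# Termwise absolute convergence in the sheared coordinates: both sides of the pole plane

(Line `janus-bands`, crux `ArrangementNormalForm`, stub `stub_separateThreeZero`, part `HIReflect`
of the termwise numerator split `separateThree_hI` under the rim condition.)

`core` (registered as `separateThree_reflect`): part `HICore` with the normalisation "the cell lies
above the pole plane" replaced by the pole condition "`w ≠ 0` on the cell when `n ≠ 0`". The
convex cell lies on one side of the pole plane (`snd_pos_or_neg`); the lower side is reduced to
the upper side by the measure-preserving reflection `(v, w) ↦ (v, −w)`, under which the cell, the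
integrand, the Taylor pieces (coefficients `(−1)^{i+n} qᵢ`) and the rim condition keep their form.
-/

noncomputable section

open Set MeasureTheory Filter Topology
open scoped ENNReal

namespace Summit.KontsevichZagierPeriods.ArrangementNormalForm.JanusBands

namespace SepThree

section Reflect

variable {J m : ℕ} (g : Fin J → Con) (κ : Fin m → Fin 2 → ℝ) (μ : Fin m → ℝ) (e : Fin m → ℕ)
  (N : ℕ) (q : ℕ → MvPolynomial (Fin 2) ℝ) (n : ℕ)

/-- The reflection `(v, w) ↦ (v, -w)`. -/
def refl3 (p : (Fin 2 → ℝ) × ℝ) : (Fin 2 → ℝ) × ℝ := (p.1, -p.2)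

/-- The reflection is an involution. -/
@[simp] theorem refl3_refl3 (p : (Fin 2 → ℝ) × ℝ) : refl3 (refl3 p) = p := by simp [refl3]

/-- The reflection as a homeomorphism. -/
def refl3Homeo : (Fin 2 → ℝ) × ℝ ≃ₜ (Fin 2 → ℝ) × ℝ :=
  (Homeomorph.refl (Fin 2 → ℝ)).prodCongr (Homeomorph.neg ℝ)

/-- The homeomorphism is the reflection. -/
theorem refl3Homeo_apply (p : (Fin 2 → ℝ) × ℝ) : refl3Homeo p = refl3 p := rfl

/-- The reflection preserves Lebesgue measure. -/
theorem measurePreserving_refl3 : MeasurePreserving refl3 (volume : Measure ((Fin 2 → ℝ) × ℝ)) volume :=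
  (MeasurePreserving.id (volume : Measure (Fin 2 → ℝ))).prod (Measure.measurePreserving_neg (volume : Measure ℝ))

/-- The reflected constraints. -/
def reflC (t : Con) : Con := (t.1, -t.2.1, t.2.2)

/-- Values of the reflected constraints. -/
theorem cval_reflC (t : Con) (p : (Fin 2 → ℝ) × ℝ) : cval (reflC t) p = cval t (refl3 p) := by
  simp only [cval, reflC, refl3]; ring

/-- The reflected cell. -/
theorem Om3_reflC : Om3 (fun j => reflC (g j)) = refl3 ⁻¹' Om3 g := by
  ext p; simp [Om3, cval_reflC]

/-- The reflected Taylor coefficients `(−1)^{i+n} qᵢ`. -/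
def reflQ (i : ℕ) : MvPolynomial (Fin 2) ℝ := MvPolynomial.C ((-1 : ℝ) ^ (i + n)) * q i

/-- Values of the reflected coefficients. -/
theorem Qv_reflQ (i : ℕ) (v : Fin 2 → ℝ) : Qv (reflQ q n) i v = (-1) ^ (i + n) * Qv q i v := by
  simp [Qv, reflQ]

/-- The reflected integrand is the integrand composed with the reflection. -/
theorem Fform_reflQ (p : (Fin 2 → ℝ) × ℝ) :
    Fform κ μ e N (reflQ q n) n p = Fform κ μ e N q n (refl3 p) := by
  simp only [Fform, refl3, psum, Qv_reflQ]
  have h1 : ∀ i, (-1 : ℝ) ^ (i + n) * Qv q i p.1 * p.2 ^ i = (Qv q i p.1 * (-p.2) ^ i) * (-1) ^ n := fun i => by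
    rw [pow_add, neg_pow]; ring
  simp_rw [h1, ← Finset.sum_mul]
  rw [show (1 / -p.2) ^ n = (-1) ^ n * (1 / p.2) ^ n by rw [← mul_pow]; congr 1; field_simp]
  ring

/-- The reflected pieces are the pieces composed with the reflection. -/
theorem tpiece_reflQ (i : ℕ) (p : (Fin 2 → ℝ) × ℝ) :
    tpiece κ μ e (reflQ q n) n i p = tpiece κ μ e q n i (refl3 p) := by
  have key : (-p.2) ^ i / (-p.2) ^ n = (-1) ^ (i + n) * (p.2 ^ i / p.2 ^ n) := by
    rw [neg_pow, neg_pow p.2 n]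
    rcases eq_or_ne (p.2 ^ n) 0 with h0 | h0
    · simp [h0]
    · rw [mul_div_mul_comm, pow_add]
      congr 1
      rw [div_eq_iff (pow_ne_zero n (by norm_num : (-1 : ℝ) ≠ 0)), mul_assoc, ← mul_pow, neg_one_mul,
        neg_neg, one_pow, mul_one]
  simp only [tpiece, refl3, Qv_reflQ, key]
  ring

/-- **A convex cell missing the pole plane lies on one side of it.** -/
theorem snd_pos_or_neg (hpole : ∀ p ∈ Om3 g, p.2 ≠ 0) :
    (∀ p ∈ Om3 g, 0 < p.2) ∨ (∀ p ∈ Om3 g, p.2 < 0) := by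
  by_contra hcon
  push Not at hcon
  obtain ⟨⟨p₂, hp₂, h₂⟩, ⟨p₁, hp₁, h₁⟩⟩ := hcon
  have h₂' : p₂.2 < 0 := (lt_of_le_of_ne h₂ (hpole p₂ hp₂))
  have h₁' : 0 < p₁.2 := (lt_of_le_of_ne h₁ (hpole p₁ hp₁).symm)
  set t : ℝ := p₁.2 / (p₁.2 - p₂.2) with ht
  have hden : 0 < p₁.2 - p₂.2 := by linarith
  have ht0 : 0 < t := div_pos h₁' hden
  have ht1 : t < 1 := (div_lt_one hden).2 (by linarith)
  have hmem : (1 - t) • p₁ + t • p₂ ∈ Om3 g :=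
    convex_Om3 g hp₁ hp₂ (by linarith) ht0.le (by ring)
  have hzero : ((1 - t) • p₁ + t • p₂).2 = 0 := by
    simp only [Prod.snd_add, Prod.smul_snd, smul_eq_mul, ht]
    field_simp
    ring
  exact hpole _ hmem hzero

/-- **Termwise absolute convergence in the sheared coordinates, both sides of the pole plane.** -/
theorem core (hbd : Bornology.IsBounded (Om3 g))
    (hpole : n ≠ 0 → ∀ p ∈ Om3 g, p.2 ≠ 0) (hint : IntegrableOn (Fform κ μ e N q n) (Om3 g))
    (hnd : ∀ j, e j ≠ 0 → ¬(κ j = 0 ∧ μ j = 0))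
    (hRim : ∀ p ∈ closure (Om3 g), (∃ j, e j ≠ 0 ∧ lval κ μ j p.1 = 0) →
      (n ≠ 0 ∧ p.2 = 0) ∨ ∃ p' ∈ closure (Om3 g), p' ≠ p ∧ p'.1 = p.1)
    (i : ℕ) (hi : i < N) : IntegrableOn (tpiece κ μ e q n i) (Om3 g) := by
  by_cases hn : n = 0
  · exact core_pos g κ μ e N q n hbd (fun h => absurd hn h) hint hnd hRim i hi
  rcases snd_pos_or_neg g (hpole hn) with hup | hdown
  · exact core_pos g κ μ e N q n hbd (fun _ => hup) hint hnd hRim i hi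
  · -- reflect
    set g' : Fin J → Con := fun j => reflC (g j) with hg'
    have hΩ' : Om3 g' = refl3 ⁻¹' Om3 g := Om3_reflC g
    have hemb : MeasurableEmbedding refl3 := refl3Homeo.measurableEmbedding
    have hbd' : Bornology.IsBounded (Om3 g') := by
      obtain ⟨r, hr⟩ := hbd.subset_ball 0
      rw [hΩ']
      refine (Metric.isBounded_iff_subset_ball 0).2 ⟨r, fun p hp => ?_⟩
      have := hr hp
      rw [Metric.mem_ball, dist_zero_right] at this ⊢
      simpa [refl3, Prod.norm_def] using this
    have hpos' : n ≠ 0 → ∀ p ∈ Om3 g', 0 < p.2 := fun _ p hp => by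
      rw [hΩ'] at hp
      have := hdown _ hp
      simp only [refl3] at this
      linarith
    have hint' : IntegrableOn (Fform κ μ e N (reflQ q n) n) (Om3 g') := by
      rw [hΩ', show Fform κ μ e N (reflQ q n) n = Fform κ μ e N q n ∘ refl3 from
        funext (Fform_reflQ κ μ e N q n)]
      exact (measurePreserving_refl3.integrableOn_comp_preimage hemb).2 hint
    have hcl : closure (Om3 g') = refl3 ⁻¹' closure (Om3 g) := by
      rw [hΩ']
      exact (refl3Homeo.preimage_closure (Om3 g)).symm
    have hRim' : ∀ p ∈ closure (Om3 g'), (∃ j, e j ≠ 0 ∧ lval κ μ j p.1 = 0) →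
        (n ≠ 0 ∧ p.2 = 0) ∨ ∃ p' ∈ closure (Om3 g'), p' ≠ p ∧ p'.1 = p.1 := by
      intro p hp hj
      rw [hcl] at hp
      rcases hRim (refl3 p) hp hj with ⟨hn', h0⟩ | ⟨p'', hp'', hne, hfst⟩
      · left
        simp only [refl3, neg_eq_zero] at h0
        exact ⟨hn', h0⟩
      · right
        refine ⟨refl3 p'', ?_, fun heq => hne ?_, by simpa [refl3] using hfst⟩
        · rw [hcl, mem_preimage, refl3_refl3]; exact hp''
        · rw [← heq, refl3_refl3]
    have hcore := core_pos g' κ μ e N (reflQ q n) n hbd' hpos' hint' hnd hRim' i hi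
    rw [hΩ', show tpiece κ μ e (reflQ q n) n i = tpiece κ μ e q n i ∘ refl3 from
      funext (tpiece_reflQ κ μ e q n i)] at hcore
    exact (measurePreserving_refl3.integrableOn_comp_preimage hemb).1 hcore

end Reflect

end SepThree

/-- **Termwise absolute convergence in the sheared coordinates, both sides of the pole plane**
(registered part of `stub_separateThreeZero`; literal form of `SepThree.core`): for a bounded open
polyhedral cell `Ω ⊆ (Fin 2 → ℝ) × ℝ` on which `w ≠ 0` when `n ≠ 0`, with the integrand
`Fform = (∑_{i<N} Qᵢ(v) w^i)/Wt(v) · w^{-n}` absolutely integrable on `Ω`, no letter of non-zero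
exponent identically zero, and the rim condition, every Taylor piece `Qᵢ(v)/Wt(v) · w^i/w^n`,
`i < N`, is absolutely integrable on `Ω`. -/
theorem separateThree_reflect {J m : ℕ} (g : Fin J → (Fin 2 → ℝ) × ℝ × ℝ) (κ : Fin m → Fin 2 → ℝ) (μ : Fin m → ℝ) (e : Fin m → ℕ) (N : ℕ) (q : ℕ → MvPolynomial (Fin 2) ℝ) (n : ℕ) (hbd : Bornology.IsBounded (SepThree.Om3 g)) (hpole : n ≠ 0 → ∀ p ∈ SepThree.Om3 g, p.2 ≠ 0) (hint : MeasureTheory.IntegrableOn (SepThree.Fform κ μ e N q n) (SepThree.Om3 g)) (hnd : ∀ j, e j ≠ 0 → ¬(κ j = 0 ∧ μ j = 0)) (hRim : ∀ p ∈ closure (SepThree.Om3 g), (∃ j, e j ≠ 0 ∧ SepThree.lval κ μ j p.1 = 0) → (n ≠ 0 ∧ p.2 = 0) ∨ ∃ p' ∈ closure (SepThree.Om3 g), p' ≠ p ∧ p'.1 = p.1) (i : ℕ) (hi : i < N) : MeasureTheory.IntegrableOn (SepThree.tpiece κ μ e q n i) (SepThree.Om3 g) := by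
  exact SepThree.core g κ μ e N q n hbd hpole hint hnd hRim i hi

end Summit.KontsevichZagierPeriods.ArrangementNormalForm.JanusBands
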